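import Summits.CriticalPhenomena.CardyFormulaZ2.Theorems.CardyMagicRigidityLoopsToCrossingsStubNotDiscreteCrossingOfDualPathIn
import Summits.CriticalPhenomena.CardyFormulaZ2.Theorems.ModulusResponseSmirnovCellAnchorCellPaths
import Summits.CriticalPhenomena.CardyFormulaZ2.Theorems.ModulusResponseSmirnovCellAnchorFrame

/-!
# Upper half of the cell/site sandwich: a closed `𝕋`-path blocks every G02 cell crossing of `ℤ²`
(support item `SmirnovCellAnchor`)

Helper file for `Summit.CriticalPhenomena.CardyFormulaZ2.Theses.ModulusResponse.SmirnovCellAnchor`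
(stmt-CriticalPhenomena-6471). Setting as in the lower half (`…LowerDet`): cell configuration
`Φ X` on `ℤ²` in the frame of the conformal rectangle `Q`, sites of `𝕋` read in the frame of
`W = g(Q)`. **Upper half** (Bollobás–Riordan 2006, Ch. 7, Claim 19 p. 192 and remark p. 195,
cell/site port): for `ρ > 0` and all small `δ`, `t`, a `𝕋`-path of *closed* sites (off `X`) from a
site `4δ`-off `W` near `W.arc 1` to one near `W.arc 3`, whose off-`W` sites are `t`-close to
`W.arc 1 ∪ W.arc 3`, whose in-`W` sites are `8δ`-off `W.arc 0 ∪ W.arc 2` and all of whose sites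
are `ρ`-off the marked points, excludes the G02 crossing event
`Φ X ∈ discreteCrossing Q δ (Q.arc 0) (Q.arc 2)`. Proof: the path is a dual-open nearest-neighbour
path of `dualConfig (Φ X)` through the dual vertices `m - 𝟙` of its sites and the corner vertices
of its diagonal steps (`pathIn_dual_of_pathIn_triGraph`), each planar dual position being within
one mesh step of a path site; the hypotheses transfer (frame change, corner separation); then the
`ℤ²` blocking theorem `stub_not_discreteCrossing_of_dualPathIn` of the tree applies (Newman's
cross-cut theorem inside).
-/

noncomputable section

namespace Summit.CriticalPhenomena.CardyFormulaZ2.Theorems.SmirnovCellAnchor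

open Set Metric Complex
open Literature.Probability.Percolation Literature.Probability.LatticeModels
  Literature.Probability.RandomPlanarGeometry
open Summit.CriticalPhenomena.CardyFormulaZ2.Cruxes.LoopsToCrossings.OracleSandwich

/-- The planar dual position of the dual vertex `m - 𝟙` is within one mesh step of the site `m`
(it is the point `δ m - δ (1 + i)/2`). [folklore] -/
theorem dist_dualScale_sub_one_le {δ : ℝ} (hδ : 0 < δ) (m : Site 2) :
    dist (dualScale δ (Site.toComplex (m - 1))) (meshPoint δ m) ≤ δ := by
  rw [Complex.dist_eq]
  refine (Complex.norm_le_abs_re_add_abs_im _).trans ?_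
  have hre : (dualScale δ (Site.toComplex (m - 1)) - meshPoint δ m).re = -(δ / 2) := by
    simp only [sub_re, dualScale_apply, dualOffset_eq, add_re, mul_re, ofReal_re, Site.toComplex_re,
      Pi.sub_apply, Pi.one_apply, Int.cast_sub, Int.cast_one, ofReal_im, Site.toComplex_im, zero_mul,
      sub_zero, div_ofNat_re, one_re, I_re, add_zero, div_ofNat_im, add_im, one_im, I_im, zero_add,
      meshPoint_re]
    ring
  have him : (dualScale δ (Site.toComplex (m - 1)) - meshPoint δ m).im = -(δ / 2) := by
    simp only [sub_im, dualScale_apply, dualOffset_eq, add_im, mul_im, ofReal_re, Site.toComplex_im,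
      Pi.sub_apply, Pi.one_apply, Int.cast_sub, Int.cast_one, ofReal_im, Site.toComplex_re, zero_mul,
      add_zero, div_ofNat_re, div_ofNat_im, add_im, one_im, I_im, zero_add,
      meshPoint_im]
    ring
  rw [hre, him, abs_neg, abs_of_pos (by positivity)]
  linarith

/-- The planar dual position of a corner vertex `w` is within one mesh step of the site `w + e₀`
(it is the point `δ (w + e₀) + δ (-1 + i)/2`). [folklore] -/
theorem dist_dualScale_corner_le {δ : ℝ} (hδ : 0 < δ) (w : Site 2) :
    dist (dualScale δ (Site.toComplex w)) (meshPoint δ (w + Pi.single 0 1)) ≤ δ := by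
  rw [Complex.dist_eq]
  refine (Complex.norm_le_abs_re_add_abs_im _).trans ?_
  have hre : (dualScale δ (Site.toComplex w) - meshPoint δ (w + Pi.single 0 1)).re = -(δ / 2) := by
    simp only [sub_re, dualScale_apply, dualOffset_eq, add_re, mul_re, ofReal_re, Site.toComplex_re,
      ofReal_im, Site.toComplex_im, zero_mul, sub_zero, div_ofNat_re, one_re, I_re, add_zero,
      div_ofNat_im, add_im, one_im, I_im, zero_add, meshPoint_re, Pi.add_apply, Pi.single_eq_same,
      Int.cast_add, Int.cast_one]
    ring
  have him : (dualScale δ (Site.toComplex w) - meshPoint δ (w + Pi.single 0 1)).im = δ / 2 := by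
    simp only [sub_im, dualScale_apply, dualOffset_eq, add_im, mul_im, ofReal_re, Site.toComplex_im,
      ofReal_im, Site.toComplex_re, zero_mul, add_zero, div_ofNat_re, div_ofNat_im,
      one_im, I_im, zero_add, meshPoint_im, Pi.add_apply, ne_eq, one_ne_zero, not_false_eq_true,
      Pi.single_eq_of_ne]
    ring
  rw [hre, him, abs_neg, abs_of_pos (by positivity)]
  linarith

/-- **Upper half of the cell/site sandwich, deterministic form** (see the module docstring).
[cite: BollobasRiordan2006, Ch. 7 Claim 19 p. 192 and remark p. 195] -/
theorem cell_not_mem_discreteCrossing_of_pathIn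
    (Φ : Set (Site 2) → BondConfig (Site 2))
    (hΦ : ∀ X, Φ X = {e | ∃ m ∈ X, e = s(m - Pi.single 0 1, m) ∨ e = s(m - Pi.single 1 1, m)})
    (g : ℂ → ℂ) (hg : ∀ z, g z = (z.re : ℂ) + (z.im : ℂ) * triZeta)
    (Q W : ConformalRectangle) (hW : W.carrier = g '' Q.carrier)
    (hWarc : ∀ i, W.arc i = g '' Q.arc i) (hWpt : ∀ j, W.pt j = g (Q.pt j)) {ρ : ℝ} (hρ : 0 < ρ) :
    ∃ δ₀ > 0, ∃ t₀ > 0, ∀ δ t : ℝ, 0 < δ → δ < δ₀ → 0 ≤ t → t ≤ t₀ →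
      ∀ (X S : Set (Site 2)) (u v : Site 2), S ⊆ Xᶜ →
        (∀ x ∈ S, triMeshPoint δ x ∉ W.carrier →
          infDist (triMeshPoint δ x) (W.arc 1) ≤ t ∨ infDist (triMeshPoint δ x) (W.arc 3) ≤ t) →
        (∀ x ∈ S, triMeshPoint δ x ∈ W.carrier →
          8 * δ < infDist (triMeshPoint δ x) (W.arc 0) ∧ 8 * δ < infDist (triMeshPoint δ x) (W.arc 2)) →
        (∀ x ∈ S, ∀ j : Fin 4, ρ ≤ dist (triMeshPoint δ x) (W.pt j)) →
        4 * δ ≤ infDist (triMeshPoint δ u) W.carrier → infDist (triMeshPoint δ u) (W.arc 1) ≤ t →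
        4 * δ ≤ infDist (triMeshPoint δ v) W.carrier → infDist (triMeshPoint δ v) (W.arc 3) ≤ t →
        PathIn triGraph S u v →
        Φ X ∉ discreteCrossing Q.carrier δ (Q.arc 0) (Q.arc 2) := by
  obtain ⟨δB, hδB, tB, htB, hB⟩ := stub_not_discreteCrossing_of_dualPathIn Q (ρ / 8) (by positivity)
  obtain ⟨κ, hκ, hfar_arc⟩ := far_arc_of_far_corners Q (ρ₀ := ρ / 8) (by positivity)
  refine ⟨min δB (min (tB / 8) (min (κ / 8) (ρ / 8))), by positivity, min (tB / 8) (κ / 8), by positivity, ?_⟩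
  intro δ t hδ hδlt ht htle X S u v hSX hout hin hcorner huW huA hvW hvB hP
  have hδB' : δ < δB := hδlt.trans_le (min_le_left _ _)
  have hδtB : δ < tB / 8 := hδlt.trans_le ((min_le_right _ _).trans (min_le_left _ _))
  have hδκ : δ < κ / 8 := hδlt.trans_le ((min_le_right _ _).trans ((min_le_right _ _).trans (min_le_left _ _)))
  have hδρ : δ < ρ / 8 := hδlt.trans_le ((min_le_right _ _).trans ((min_le_right _ _).trans (min_le_right _ _)))
  have httB : t ≤ tB / 8 := htle.trans (min_le_left _ _)
  have htκ : t ≤ κ / 8 := htle.trans (min_le_right _ _)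
  -- frame transfer
  have hgm : ∀ x : Site 2, g (meshPoint δ x) = triMeshPoint δ x := g_meshPoint g hg δ
  have hmemW : ∀ x : Site 2, triMeshPoint δ x ∈ W.carrier ↔ meshPoint δ x ∈ Q.carrier := fun x => by
    rw [← hgm, hW, g_mem_image_iff g hg]
  have hmemW' : ∀ p : ℂ, g p ∈ W.carrier ↔ p ∈ Q.carrier := fun p => by rw [hW, g_mem_image_iff g hg]
  have hdn : ∀ (x : Site 2) (i : Fin 4), infDist (meshPoint δ x) (Q.arc i) ≤ 2 * infDist (triMeshPoint δ x) (W.arc i) :=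
    fun x i => by rw [hWarc, ← hgm]; exact infDist_le_two_mul_infDist_g g hg _ _
  have hup : ∀ (x : Site 2) (i : Fin 4), infDist (triMeshPoint δ x) (W.arc i) ≤ 2 * infDist (meshPoint δ x) (Q.arc i) :=
    fun x i => by rw [hWarc, ← hgm]; exact infDist_g_le_two_mul_infDist g hg _ _
  have hcor : ∀ x ∈ S, ∀ j : Fin 4, ρ / 2 ≤ dist (meshPoint δ x) (Q.pt j) := fun x hx j => by
    refine half_le_dist_of_le_dist_g g hg ?_
    rw [hgm, ← hWpt]; exact hcorner x hx j
  have hSout : ∀ x ∈ S, meshPoint δ x ∉ Q.carrier →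
      infDist (meshPoint δ x) (Q.arc 1) ≤ 2 * t ∨ infDist (meshPoint δ x) (Q.arc 3) ≤ 2 * t := by
    intro x hx hxQ
    rcases hout x hx (fun h => hxQ ((hmemW x).1 h)) with h | h
    · exact Or.inl ((hdn x 1).trans (by linarith))
    · exact Or.inr ((hdn x 3).trans (by linarith))
  have hSin : ∀ x ∈ S, meshPoint δ x ∈ Q.carrier →
      4 * δ < infDist (meshPoint δ x) (Q.arc 0) ∧ 4 * δ < infDist (meshPoint δ x) (Q.arc 2) := by
    intro x hx hxQ
    obtain ⟨h0, h2⟩ := hin x hx ((hmemW x).2 hxQ)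
    exact ⟨by linarith [hup x 0], by linarith [hup x 2]⟩
  have hfr : frontier Q.carrier ⊆ (Q.arc 1 ∪ Q.arc 3) ∪ (Q.arc 0 ∪ Q.arc 2) := frontier_subset_arcs_one_three Q
  -- the dual path and its vertex set
  set D : Set (Site 2) := {d | d + 1 ∈ S} ∪ {w | w + Pi.single 0 1 ∈ S ∧ w + Pi.single 1 1 ∈ S} with hD
  have hpath : PathIn (openGraph (dualConfig (Φ X)) ⊓ zdGraph 2) D (u - 1) (v - 1) :=
    pathIn_dual_of_pathIn_triGraph Φ hΦ hSX hP
  -- every dual position is within `δ` of a path site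
  have hnear : ∀ x ∈ D, ∃ m ∈ S, dist (dualScale δ (Site.toComplex x)) (meshPoint δ m) ≤ δ := by
    rintro x (hx | ⟨hx0, -⟩)
    · refine ⟨x + 1, hx, ?_⟩
      have := dist_dualScale_sub_one_le hδ (x + 1)
      rwa [add_sub_cancel_right] at this
    · exact ⟨_, hx0, dist_dualScale_corner_le hδ x⟩
  -- estimates for a point `p` within `δ` of a path site `m`
  have hpout : ∀ (p : ℂ), ∀ m ∈ S, dist p (meshPoint δ m) ≤ δ → p ∉ Q.carrier →
      infDist p (Q.arc 1) ≤ 2 * t + 2 * δ ∨ infDist p (Q.arc 3) ≤ 2 * t + 2 * δ := by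
    intro p m hm hpm hpQ
    by_cases hmQ : meshPoint δ m ∈ Q.carrier
    · have hseg : ¬ segment ℝ (meshPoint δ m) p ⊆ Q.carrier := fun h => hpQ (h (right_mem_segment ℝ _ _))
      obtain ⟨f, hf, hffr⟩ := exists_mem_segment_frontier Q.isOpen hmQ hseg
      have hfm : dist f (meshPoint δ m) ≤ δ := by
        have hsub : segment ℝ (meshPoint δ m) p ⊆ closedBall (meshPoint δ m) δ :=
          (convex_closedBall _ _).segment_subset (mem_closedBall_self hδ.le) (mem_closedBall.2 hpm)
        exact mem_closedBall.1 (hsub hf)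
      have hfp : dist p f ≤ 2 * δ := by
        have := dist_triangle p (meshPoint δ m) f
        rw [dist_comm f] at hfm; linarith
      obtain ⟨h0, h2⟩ := hSin m hm hmQ
      have hf02 : f ∉ Q.arc 0 ∪ Q.arc 2 := by
        rintro (hf0 | hf2)
        · have := infDist_le_dist_of_mem (x := meshPoint δ m) hf0
          rw [dist_comm] at hfm; linarith
        · have := infDist_le_dist_of_mem (x := meshPoint δ m) hf2
          rw [dist_comm] at hfm; linarith
      rcases hfr hffr with (hf1 | hf3) | hf02'
      · exact Or.inl ((infDist_le_dist_of_mem hf1).trans (by linarith))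
      · exact Or.inr ((infDist_le_dist_of_mem hf3).trans (by linarith))
      · exact absurd hf02' hf02
    · rcases hSout m hm hmQ with h | h
      · left
        have := infDist_le_infDist_add_dist (s := Q.arc 1) (x := p) (y := meshPoint δ m)
        linarith
      · right
        have := infDist_le_infDist_add_dist (s := Q.arc 3) (x := p) (y := meshPoint δ m)
        linarith
  have hpfar : ∀ (p : ℂ), ∀ m ∈ S, dist p (meshPoint δ m) ≤ δ → ∀ j : Fin 4, ρ / 8 ≤ dist p (Q.pt j) := by
    intro p m hm hpm j
    have := hcor m hm j
    have := dist_triangle (meshPoint δ m) p (Q.pt j)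
    rw [dist_comm (meshPoint δ m) p] at this
    linarith
  have hpin : ∀ (p : ℂ), ∀ m ∈ S, dist p (meshPoint δ m) ≤ δ → p ∈ Q.carrier →
      3 * δ < infDist p (Q.arc 0) ∧ 3 * δ < infDist p (Q.arc 2) := by
    intro p m hm hpm hpQ
    by_cases hmQ : meshPoint δ m ∈ Q.carrier
    · obtain ⟨h0, h2⟩ := hSin m hm hmQ
      have e0 := infDist_le_infDist_add_dist (s := Q.arc 0) (x := meshPoint δ m) (y := p)
      have e2 := infDist_le_infDist_add_dist (s := Q.arc 2) (x := meshPoint δ m) (y := p)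
      rw [dist_comm] at e0 e2
      exact ⟨by linarith, by linarith⟩
    · have key : ∀ i : Fin 4, (i = 1 ∨ i = 3) → infDist (meshPoint δ m) (Q.arc i) ≤ 2 * t →
          3 * δ < infDist p (Q.arc 0) ∧ 3 * δ < infDist p (Q.arc 2) := by
        intro i hi hmi
        have hpi : infDist p (Q.arc i) < κ := by
          have := infDist_le_infDist_add_dist (s := Q.arc i) (x := p) (y := meshPoint δ m)
          linarith
        have h0 := hfar_arc p (hpfar p m hm hpm) i 0 (by rcases hi with rfl | rfl <;> decide) hpi
        have h2 := hfar_arc p (hpfar p m hm hpm) i 2 (by rcases hi with rfl | rfl <;> decide) hpi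
        exact ⟨by linarith, by linarith⟩
      rcases hSout m hm hmQ with h | h
      · exact key 1 (Or.inl rfl) h
      · exact key 3 (Or.inr rfl) h
  -- the endpoints are off `Q`
  have hend : ∀ x : Site 2, 4 * δ ≤ infDist (triMeshPoint δ x) W.carrier →
      dualScale δ (Site.toComplex (x - 1)) ∉ Q.carrier := by
    intro x hx hxQ
    have h1 : g (dualScale δ (Site.toComplex (x - 1))) ∈ W.carrier := (hmemW' _).2 hxQ
    have h2 : infDist (triMeshPoint δ x) W.carrier ≤ dist (triMeshPoint δ x) (g (dualScale δ (Site.toComplex (x - 1)))) :=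
      infDist_le_dist_of_mem h1
    have h3 : dist (triMeshPoint δ x) (g (dualScale δ (Site.toComplex (x - 1)))) ≤ 2 * δ := by
      rw [← hgm, dist_comm]
      exact (dist_g_le_two_mul_dist g hg _ _).trans (by linarith [dist_dualScale_sub_one_le hδ x])
    linarith
  -- apply the `ℤ²` blocking theorem
  refine hB δ (2 * t + 2 * δ) hδ hδB' (by positivity) (by linarith) (Φ X) D (u - 1) (v - 1)
    ?_ ?_ ?_ (hend u huW) ?_ (hend v hvW) ?_ hpath
  · intro x hx hxQ
    obtain ⟨m, hm, hpm⟩ := hnear x hx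
    exact hpout _ m hm hpm hxQ
  · intro x hx hxQ
    obtain ⟨m, hm, hpm⟩ := hnear x hx
    exact hpin _ m hm hpm hxQ
  · intro x hx _ j
    obtain ⟨m, hm, hpm⟩ := hnear x hx
    exact hpfar _ m hm hpm j
  · have := infDist_le_infDist_add_dist (s := Q.arc 1) (x := dualScale δ (Site.toComplex (u - 1))) (y := meshPoint δ u)
    have := dist_dualScale_sub_one_le hδ u
    have := hdn u 1
    linarith
  · have := infDist_le_infDist_add_dist (s := Q.arc 3) (x := dualScale δ (Site.toComplex (v - 1))) (y := meshPoint δ v)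
    have := dist_dualScale_sub_one_le hδ v
    have := hdn v 3
    linarith

end Summit.CriticalPhenomena.CardyFormulaZ2.Theorems.SmirnovCellAnchor

end
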